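import Summits.ValiantsHypothesis.ValiantsHypothesis.Theses.ShallowShadows
import Literature.Computability.Complexity.LindseyLemma
import Literature.Computability.Complexity.MonotoneMatchingDepth
import Summits.ValiantsHypothesis.ValiantsHypothesis.Theorems.RazWigdersonMatching.Negative.ThresholdAndNonVacuity
import Summits.ValiantsHypothesis.ValiantsHypothesis.Theorems.ShallowShadowsRazWigdersonMatchingStubKwPartition
import Summits.ValiantsHypothesis.ValiantsHypothesis.Theorems.ShallowShadowsRazWigdersonMatchingStubSymmetrise
import Summits.ValiantsHypothesis.ValiantsHypothesis.Theorems.ShallowShadowsRazWigdersonMatchingStubEmbedding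
import Summits.ValiantsHypothesis.ValiantsHypothesis.Theorems.ShallowShadowsRazWigdersonMatchingStubPmInvariant
import Summits.ValiantsHypothesis.ValiantsHypothesis.Theorems.ShallowShadowsRazWigdersonMatchingStubParitySumLB
import Summits.ValiantsHypothesis.ValiantsHypothesis.Theorems.ShallowShadowsRazWigdersonMatchingStubEndgame

/-!
# Raz–Wigderson: monotone formulas for bipartite perfect matching have size `2^{Ω(m)}`

Closes the crux `Summit.ValiantsHypothesis.ValiantsHypothesis.Theses.ShallowShadows.RazWigdersonMatching`
(item `stmt-ValiantsHypothesis-17127`, route `ShallowShadows`; the FAR SIDE of the shadow transfer):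
`∃ c > 0, ∃ m₀, ∀ m ≥ m₀, 2 ^ (c·m) ≤ formulaSizeOver monotoneBasis (perfectMatchingFn m)` —
R. Raz, A. Wigderson, *Monotone circuits for matching require linear depth*, J. ACM 39 (1992),
Thm. 4.2 (with formula balancing; quoted in this form by Cavalar–Göös–Riazanov–Sofronova–Sokolov
2026, §1.2). The statement is literally the Literature named fact
`Literature.Computability.Complexity.RazWigderson1992_bpm_monotoneFormulaSize`, which is therefore
discharged here as well (`RazWigderson1992_bpm_monotoneFormulaSize_holds`).

## The proof formalised here (line `Sketch` = idea `parity-harmonic` of the crux chain)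

NOT the printed proof (randomized communication complexity of disjointness + balancing) but
PARITY AGAINST THE EXACT HARMONIC PROFILE, whose only analytic input is Lindsey's lemma
(`Literature.Computability.Complexity.lindsey`, proved in the tree):

1. (`stub_kwPartition`, Karchmer–Wigderson in LEAF form) a monotone formula with `s` gates for
   `PM_m` gives a labelled rectangle PARTITION of `PM⁻¹(1) × PM⁻¹(0)` into `L ≤ s + 1` parts on
   which the label is a valid monotone KW answer.
2. (`stub_embedding`, Raz–Wigderson's vertex duplication with Rao–Yehudayoff's planted edge) for
   `u = ⌊(m−1)/2⌋`, pairs `(x, y)` of `u`-bit vectors embed as (permutation matrix, complement of a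
   Hall obstruction) with answer set = one planted cell + one cell per `i ∈ x ∩ y`, and the
   stabiliser in `S_m × S_m` (`stub_pmInvariant`: `PM` is relabelling invariant) reaches every
   answer from the planted one.
3. (`stub_symmetrise`, the lever) averaging over the relabellings, the pulled-back answer of ANY
   partition is uniform on the answers, so the harmonic profile `T(x,y) = 1/(1+|x∩y|)` is an EXACT
   non-negative combination of rectangles of total weight `≤ L`.
4. Pairing with the Sylvester–Hadamard sign `(−1)^{|x∩y|}`: by Lindsey every rectangle sum is
   `≤ 2^u √2^u`, so `Σ_{x,y} (−1)^{|x∩y|}/(1+|x∩y|) ≤ L · 2^u √2^u`, while (`stub_paritySumLB`)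
   the left side equals `(3^{u+1} − 2^{u+1})/(u+1) ≥ 3^u/(u+1)`.
5. Since `3 > 2√2` (`stub_endgame`), `3^u/(u+1) ≤ (s+1) 2^u √2^u` forces `s ≥ 2^{c m}` for
   `m ≥ m₀`; non-vacuity of `formulaSizeOver` for `m ≥ 1` is the landed Negative lemma
   `exists_monotoneFormula_perfectMatchingFn` (the threshold `m₀` is load-bearing:
   `razWigdersonMatching_false_without_threshold`).

References: [RazWigderson1992] Thm. 4.2; [KarchmerWigderson1990]; Rao–Yehudayoff, *Communication
Complexity* (CUP 2020), Lemma 9.2, Thm. 9.5; [Jukna2012] §3.3, §7.6, Appendix A (Lindsey);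
Chor–Goldreich 1988; [CavalarEtAl2026] §1.2 (arXiv:2507.16105).
-/

set_option linter.dupNamespace false -- single-conjunct summit: `ValiantsHypothesis.ValiantsHypothesis`

noncomputable section

namespace Summit.ValiantsHypothesis.ValiantsHypothesis.Theorems.ShallowShadowsRazWigdersonMatching

open Finset
open Literature.Computability.Complexity
open Literature.Barriers.PneNP (perfectMatchingFn perfectMatchingFn_eq_true_iff)
open Summit.ValiantsHypothesis.ValiantsHypothesis.Theses.ShallowShadows (RazWigdersonMatching)

/-! ## Rectangle sums and Lindsey's lemma on rectangles -/

/-- `Σ_{a,b} W a b · 𝟙[a ∈ X] 𝟙[b ∈ Y] = Σ_{a ∈ X} Σ_{b ∈ Y} W a b` (rectangle sums). [folklore] -/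
theorem sum_mul_indicator_rect {α β : Type} [Fintype α] [Fintype β] [DecidableEq α]
    [DecidableEq β] (W : α → β → ℝ) (X : Finset α) (Y : Finset β) :
    ∑ a, ∑ b, W a b * ((if a ∈ X then (1 : ℝ) else 0) * (if b ∈ Y then (1 : ℝ) else 0)) =
      ∑ a ∈ X, ∑ b ∈ Y, W a b := by
  have inner : ∀ a, ∑ b, W a b * ((if a ∈ X then (1 : ℝ) else 0) * (if b ∈ Y then (1 : ℝ) else 0))
      = if a ∈ X then ∑ b ∈ Y, W a b else 0 := by
    intro a
    by_cases ha : a ∈ X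
    · simp only [ha, if_true, one_mul]
      have hb : ∀ b, W a b * (if b ∈ Y then (1 : ℝ) else 0) = if b ∈ Y then W a b else 0 :=
        fun b => by split_ifs <;> simp
      rw [Finset.sum_congr rfl (fun b _ => hb b), Finset.sum_ite_mem, Finset.univ_inter]
    · simp [ha]
  rw [Finset.sum_congr rfl (fun a _ => inner a), Finset.sum_ite_mem, Finset.univ_inter]

/-- Lindsey's lemma on a rectangle of `{0,1}^u × {0,1}^u`:
`Σ_{x ∈ X} Σ_{y ∈ Y} (−1)^{|x∩y|} ≤ 2^u √2^u`. [cite: Jukna2012, Appendix A (Lindsey's Lemma)] -/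
theorem rect_sum_ipSign_le (u : ℕ) (X Y : Finset (Fin u → Bool)) :
    ∑ x ∈ X, ∑ y ∈ Y, ipSign x y ≤ (2 : ℝ) ^ u * Real.sqrt 2 ^ u := by
  classical
  have h := lindsey (n := Fin u) (fun x => if x ∈ X then (1 : ℝ) else 0)
    (fun y => if y ∈ Y then (1 : ℝ) else 0)
    (fun x => by split_ifs <;> simp) (fun y => by split_ifs <;> simp)
  rw [Fintype.card_fin] at h
  have hrew : ∑ x, ∑ y, (if x ∈ X then (1 : ℝ) else 0) * (if y ∈ Y then (1 : ℝ) else 0) * ipSign x y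
      = ∑ x ∈ X, ∑ y ∈ Y, ipSign x y := by
    rw [← sum_mul_indicator_rect (fun x y => ipSign x y) X Y]
    refine Finset.sum_congr rfl fun x _ => Finset.sum_congr rfl fun y _ => ?_
    ring
  rw [hrew] at h
  exact (le_abs_self _).trans h

/-! ## The crux -/

/-- **Raz–Wigderson (J. ACM 1992, Thm. 4.2), formula form: monotone formulas computing the
bipartite perfect matching function `PM_m` have at least `2^{c m}` gates for all `m ≥ m₀`** —
the crux `RazWigdersonMatching` of route `ShallowShadows`, proved by parity against the exact
harmonic profile (KW leaf partition + planted symmetrisation + Lindsey's lemma), see the module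
docstring. [cite: RazWigderson1992, Thm. 4.2] [cite: CavalarEtAl2026, §1.2] -/
theorem razWigdersonMatching_proof : RazWigdersonMatching := by
  obtain ⟨c, hc, m₁, hm₁⟩ := stub_endgame
  refine ⟨c, hc, max m₁ 1, ?_⟩
  intro m hm
  have hm1 : 1 ≤ m := le_trans (le_max_right _ _) hm
  have hmm₁ : m₁ ≤ m := le_trans (le_max_left _ _) hm
  -- non-vacuity (proved Negative lemma): the infimum defining `formulaSizeOver` is attained
  have hSne : {s | ∃ C : Circuit (Fin m × Fin m), C.IsOver monotoneBasis ∧ C.IsFormula ∧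
      C.Computes (perfectMatchingFn m) ∧ C.size = s}.Nonempty := by
    obtain ⟨F, hF₁, hF₂, hF₃⟩ :=
      Summit.ValiantsHypothesis.ValiantsHypothesis.Theorems.RazWigdersonMatching.Negative.exists_monotoneFormula_perfectMatchingFn
        m hm1
    exact ⟨F.size, F, hF₁, hF₂, hF₃, rfl⟩
  obtain ⟨F, hFover, hFformula, hFcomp, hFsize⟩ := Nat.sInf_mem hSne
  have hfs : formulaSizeOver monotoneBasis (perfectMatchingFn m) = F.size := by
    unfold formulaSizeOver
    exact hFsize.symm
  -- (1) the KW leaf partition of `F`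
  obtain ⟨L, hL, A, B, lab, hpart, hvalid⟩ :=
    stub_kwPartition (Fin m × Fin m) (perfectMatchingFn m) F hFover hFformula hFcomp
  -- the block size
  set u : ℕ := (m - 1) / 2 with hu
  have hun : 2 * u + 1 ≤ m := by omega
  -- (2) the planted block embedding
  obtain ⟨eA, eB, p, hA, hB, hp, hcard, htrans⟩ := stub_embedding m u hun
  -- (3) the harmonic profile as a rectangle combination of weight `≤ L`
  obtain ⟨J, w, Xs, Ys, hw0, hwsum, hstat⟩ :=
    stub_symmetrise m L (Fin u → Bool) (Fin u → Bool) (perfectMatchingFn m) (stub_pmInvariant m)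
      A B lab hpart hvalid eA eB p hA hB hp htrans
  have hT : ∀ x y : Fin u → Bool,
      ∑ j, w j * ((if x ∈ Xs j then (1 : ℝ) else 0) * (if y ∈ Ys j then (1 : ℝ) else 0)) =
        1 / ((((Finset.univ.filter fun i : Fin u => (x i && y i) = true).card : ℕ) : ℝ) + 1) := by
    intro x y
    rw [hstat x y, hcard x y]
    push_cast
    rfl
  -- (4) the parity pairing, two ways
  set S : ℝ := ∑ x : Fin u → Bool, ∑ y : Fin u → Bool,
    ipSign x y / (((Finset.univ.filter fun i : Fin u => (x i && y i) = true).card : ℝ) + 1) with hS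
  have hupper : S ≤ (L : ℝ) * ((2 : ℝ) ^ u * Real.sqrt 2 ^ u) := by
    have h1 : S = ∑ j, w j * ∑ x ∈ Xs j, ∑ y ∈ Ys j, ipSign x y := by
      have h2 : ∀ x y : Fin u → Bool,
          ipSign x y / (((Finset.univ.filter fun i : Fin u => (x i && y i) = true).card : ℝ) + 1) =
            ∑ j, w j * (ipSign x y * ((if x ∈ Xs j then (1 : ℝ) else 0) *
              (if y ∈ Ys j then (1 : ℝ) else 0))) := by
        intro x y
        rw [div_eq_mul_one_div, ← hT x y, Finset.mul_sum]
        refine Finset.sum_congr rfl fun j _ => ?_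
        ring
      calc S = ∑ x : Fin u → Bool, ∑ y : Fin u → Bool, ∑ j, w j * (ipSign x y *
              ((if x ∈ Xs j then (1 : ℝ) else 0) * (if y ∈ Ys j then (1 : ℝ) else 0))) := by
            rw [hS]
            refine Finset.sum_congr rfl fun x _ => Finset.sum_congr rfl fun y _ => h2 x y
        _ = ∑ x : Fin u → Bool, ∑ j, ∑ y : Fin u → Bool, w j * (ipSign x y *
              ((if x ∈ Xs j then (1 : ℝ) else 0) * (if y ∈ Ys j then (1 : ℝ) else 0))) := by
            refine Finset.sum_congr rfl fun x _ => ?_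
            rw [Finset.sum_comm]
        _ = ∑ j, ∑ x : Fin u → Bool, ∑ y : Fin u → Bool, w j * (ipSign x y *
              ((if x ∈ Xs j then (1 : ℝ) else 0) * (if y ∈ Ys j then (1 : ℝ) else 0))) := by
            rw [Finset.sum_comm]
        _ = ∑ j, w j * ∑ x ∈ Xs j, ∑ y ∈ Ys j, ipSign x y := by
            refine Finset.sum_congr rfl fun j _ => ?_
            rw [← sum_mul_indicator_rect (fun x y => ipSign x y) (Xs j) (Ys j), Finset.mul_sum]
            refine Finset.sum_congr rfl fun x _ => ?_
            rw [Finset.mul_sum]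
    rw [h1]
    calc ∑ j, w j * ∑ x ∈ Xs j, ∑ y ∈ Ys j, ipSign x y
        ≤ ∑ j, w j * ((2 : ℝ) ^ u * Real.sqrt 2 ^ u) :=
          Finset.sum_le_sum fun j _ =>
            mul_le_mul_of_nonneg_left (rect_sum_ipSign_le u (Xs j) (Ys j)) (hw0 j)
      _ = (∑ j, w j) * ((2 : ℝ) ^ u * Real.sqrt 2 ^ u) := by rw [Finset.sum_mul]
      _ ≤ (L : ℝ) * ((2 : ℝ) ^ u * Real.sqrt 2 ^ u) :=
          mul_le_mul_of_nonneg_right hwsum (by positivity)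
  have hlower : (3 : ℝ) ^ u / ((u : ℝ) + 1) ≤ S := stub_paritySumLB u
  -- `L ≤ s + 1`
  have hLr : (L : ℝ) ≤ (F.size : ℝ) + 1 := by exact_mod_cast hL
  have hchain : (3 : ℝ) ^ u / ((u : ℝ) + 1) ≤
      ((F.size : ℝ) + 1) * ((2 : ℝ) ^ u * Real.sqrt 2 ^ u) :=
    hlower.trans (hupper.trans (mul_le_mul_of_nonneg_right hLr (by positivity)))
  -- (5) the endgame
  rw [hfs]
  exact hm₁ m hmm₁ F.size hchain

/-- **Discharge of the Literature named fact** `RazWigderson1992_bpm_monotoneFormulaSize`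
(Raz–Wigderson 1992 Thm. 4.2 + balancing, as quoted by Cavalar et al. 2026 §1.2): it is literally
the crux just proved. [cite: RazWigderson1992, Thm. 4.2] [cite: CavalarEtAl2026, §1.2] -/
theorem RazWigderson1992_bpm_monotoneFormulaSize_holds :
    Literature.Computability.Complexity.RazWigderson1992_bpm_monotoneFormulaSize :=
  razWigdersonMatching_proof

end Summit.ValiantsHypothesis.ValiantsHypothesis.Theorems.ShallowShadowsRazWigdersonMatching

end
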